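import Literature.MathematicalPhysics.QuantumFieldTheory.Balaban1983to89.B1Eq324BenfattoKernelSect5PerBoxOnData
import Literature.MathematicalPhysics.QuantumFieldTheory.Balaban1983to89.B1Eq324BenfattoKernelSect5TupleClusters
import HarnessLib

/-!
# `Balaban1983to89.B1Eq324BenfattoKernelSect5PerBoxAppD` — [BenfattoEtAl1978] §5 pp. 157–159: the per-box relation (5.30)→(5.33)/(5.36) on
# print's objects FOR A SHIFTED GAUSSIAN KERNEL FIELD `𝒩(0,K)∘(u + ·)⁻¹` WITH THE TWO APPENDIX-D INPUTS SUPPLIED — (5.29)₂ across `Γ₄(□)` and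
# the (5.31) «(error)» at depth `w − v` — from the kernel-generic `…KernelSect5TupleClusters` and print's corridor geometry; the kernel's
# decay, the centre's size at depth and the kernel comparison at depth stay DISPLAYED as rows

statement-level skeleton of published theorems with citation tags; proofs where landed; nothing here is a claim about the
Yang–Mills mass gap

WHY THIS MODULE (cell `pub-ymgap`, seat `dag-n08-c` gen 31; node N08 [Balaban1985UV3]; the [BenfattoEtAl1978] source chain behind the
(α)-row `h324`; ROW 9 of the seat's cluster-side port map `N08-PORT-MAP-CLUSTER-SIDE.md` §1).  n08-b's `…Sect5PerBoxAppD.perBox_condField_appD`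
supplies the two Appendix-D inputs of the per-box relation for the conditioned FREE field from `…Sect5TupleClusters` and the free field's
(C.2)/(C.5)–(C.8) at depth (`…Sect5LegGeometry` §2–§4: `abs_condMean_le_of_mem_shrink`, `abs_freeCov_sub_condCov_le_of_mem_shrink`,
`abs_condCov_le_exp_l1`).  On the class road those four free-field suppliers are properties of the part kernel `K_□` and of the centre
`u_Γ(ξ)` which the class supplies from its precision (`…KernelOfPrecision` F4/F5/F7, `…ClassAppendixC`); here they are DISPLAYED as rows on a
generic `(K, u)` and a generic reference kernel `K_r` (print: `C`; class: `K_Λ`): (a) a-priori `|K|, |K_r| ≤ K₀`, (b) the decay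
`|K(x,y)| ≤ K₀e^{−δ₀ℓ¹(x,y)}`, (c) `|u| ≤ Kᵤ ≤ K₀` on `I`, (d) `|u(x)| ≤ ε₃₁` and (e) `|K(x,y) − K_r(x,y)| ≤ ε₃₁` for tesserae `x ∈ □′∪Γ₃(□) =
shrink (w + (w − v))` (depth `w − v` below the conditioning corridors), besides row 8's rows (f)–(h).  Everything else is print's geometry
and is consumed BY NAME exactly as in the concrete module: `R_A = □′∖Γ₄(□)` meets every `Ψ″₁`-tuple (`…Sect5Eq524.exists_mem_core_sdiff_frame4`),
`R_B = Γ₁(□)∪Γ₂(□)` carries `Ψ₂`, `ℓ¹ ≥ v + 1` across `Γ₄(□)` (`…Sect5LegGeometry.le_l1_core_sdiff_frame4_of_not_mem_core`,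
`not_mem_core_of_mem_frame1_union_frame2`); the cluster inputs are row 3's `abs_ursellOf_tupleSums_shift_le_exp_of_separated` /
`abs_ursellOf_tupleSums_shift_sub_kernel_le` (reference = the CENTRED field `gaussianFieldOfKernel K_r`), plugged into row 8's `perBox_shift`.

DICTIONARY.  As in `…KernelSect5PerBoxOnData`; `δ₂₉(k) = 2^{kD}2^{2^{kD}}K₀^{kD}e^{−(δ/2)(v+1)}M̃^k`, `δ₃₁(k) = M^k·2^{kD}2^{2^{kD}}·kD·K₀^{kD}·ε₃₁`,
`M` / `M̃` the decay-weighted / `δ`-inflated coefficient masses of the three classes (displayed), any rate `0 ≤ δ ≤ δ₀`.  The concrete module is the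
instance `K := condCov (freeCov …) Γ`, `u := condMean … ξ`, `K_r := freeCov d α β`, `K₀ := max(1, C₀₀, (1+2d/α²)γb)`, `δ₀ := log((2d+α²)/2d)`,
`ε₃₁` = its `max(β·2dC₀₀θ^{w−v}·γbΣ_{Γ₁}(1+d), 2dC₀₀θ^{w−v}/α²)`.

WHAT IS PROVED (theorems only; no definition, no named fact, no `sorry`; axioms standard).
* ★★ **`perBox_shift_appD`** — row 8's `perBox_shift` with `δ₂₉`, `δ₃₁` SUPPLIED from rows (a)–(e) and the reference cumulants taken under
  `𝒩(0,K_r)`: the same five-fold conclusion (`0 < lhs`, `0 < rhs`, `|log lhs − log rhs − E| ≤ Err`, `e^{E−Err}·rhs ≤ lhs ≤ e^{E+Err}·rhs`) with `Err`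
  explicit in `(s, D, d, ϰ, b, L, w, v, t, A, M, M̃, Kᵤ, K₀, c₀, ε₃₁, δ)`; private `mem_shrink_of_mem_class01`.

HONEST SCOPE / NOT HERE.  The rows (a)–(h) and the masses `M`, `M̃` stay displayed; their discharge at the class's per-box instance is row 10
(`…KernelSect5PerBoxAtPavement`) with the class's depth rows; one self-located row of an UNCOMMISSIONED port (plan g81 (II), START-LIST v11 §n08)
— nothing chained; no generalised Basic Lemma is stated; nothing of [Balaban1985UV3] is asserted; count-neutral for N08; nothing about d = 4, the
continuum, OS axioms, a mass gap or the Clay problem.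
-/

open MeasureTheory ProbabilityTheory Finset
open scoped BigOperators Nat NNReal

namespace Literature.MathematicalPhysics.QuantumFieldTheory.Balaban1983to89.B1Eq324BenfattoKernelSect5PerBoxAppD

open _root_.MeasureTheory _root_.ProbabilityTheory
open Literature.Probability.LatticeModels (setPartitions ursellOf)
open Literature.MathematicalPhysics.QuantumFieldTheory
open Literature.MathematicalPhysics.QuantumFieldTheory.Balaban1983to89.B1Eq324BenfattoLemma
open Literature.MathematicalPhysics.QuantumFieldTheory.Balaban1983to89.B1Eq324BenfattoSect5Boxes
open Literature.MathematicalPhysics.QuantumFieldTheory.Balaban1983to89.B1Eq324BenfattoSect5Eq511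
open Literature.MathematicalPhysics.QuantumFieldTheory.Balaban1983to89.B1Eq324BenfattoSect5Eq524
open Literature.MathematicalPhysics.QuantumFieldTheory.Balaban1983to89.B1Eq324BenfattoSect5Eq534
open Literature.MathematicalPhysics.QuantumFieldTheory.Balaban1983to89.B1Eq324BenfattoSect5Eq515
open Literature.MathematicalPhysics.QuantumFieldTheory.Balaban1983to89.B1Eq324GaussianMomentLeaf (momentConst one_le_momentConst)
open Literature.MathematicalPhysics.QuantumFieldTheory.Balaban1983to89.B1Eq324BenfattoSect5LegGeometry
  (le_l1_core_sdiff_frame4_of_not_mem_core not_mem_core_of_mem_frame1_union_frame2)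
open Literature.MathematicalPhysics.QuantumFieldTheory.Balaban1983to89.B1Eq324BenfattoKernelSect5PerBoxOnData (perBox_shift)
open Literature.MathematicalPhysics.QuantumFieldTheory.Balaban1983to89.B1Eq324BenfattoKernelSect5TupleClusters
  (abs_ursellOf_tupleSums_shift_le_exp_of_separated abs_ursellOf_tupleSums_shift_sub_kernel_le)

variable {d : ℕ} {K Kr : B1Eq324BenfattoLemma.Site d → B1Eq324BenfattoLemma.Site d → ℝ}

section Plug

variable {s D : ℕ} {κ : ℝ} {a : Coef d} {J I : Finset (B1Eq324BenfattoLemma.Site d)} {L w v : ℕ}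
  {m : B1Eq324BenfattoLemma.Site d} {Γ : Finset (B1Eq324BenfattoLemma.Site d)} {ξ : B1Eq324BenfattoLemma.Site d → ℝ}
  {γ b A M : ℝ}

/-- The tesserae of the `Ψ′₁`/`Ψ″₁` classes lie in `□′ ∪ Γ₃(□) = shrink (w + (w − v))` (`v ≤ w`). [cite: BenfattoEtAl1978, (5.23)/(5.27) p.157] -/
private theorem mem_shrink_of_mem_class01 (hv : v ≤ w) (T : Fin 3 → (p : ℕ) → Finset (Fin p → J))
    (hT0 : ∀ p, T 0 p = tuplesIn J p (frame4 L w v m) ∪ crossT J p (frame4 L w v m) (frame3 L w v m))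
    (hT1 : ∀ p, T 1 p = (tuplesIn J p (core L w m) \ tuplesIn J p (frame4 L w v m)) ∪
      (crossT J p (core L w m) (frame3 L w v m) \ crossT J p (frame4 L w v m) (frame3 L w v m)))
    {c : Fin 3} (hc : c = 0 ∨ c = 1) {p : ℕ} {Δ : Fin p → J} (hΔ : Δ ∈ T c p) (i : Fin p) :
    (Δ i : B1Eq324BenfattoLemma.Site d) ∈ shrink L m (w + (w - v)) := by
  have hcf : core L w m ∪ frame3 L w v m = shrink L m (w + (w - v)) := by
    rw [core_union_frame3, show 2 * w - v = w + (w - v) by omega]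
  rw [← hcf]
  have h43 : frame4 L w v m ∪ frame3 L w v m ⊆ core L w m ∪ frame3 L w v m :=
    Finset.union_subset_union (frame4_subset_core L w v m) le_rfl
  rcases hc with rfl | rfl
  · rw [hT0, Finset.mem_union] at hΔ
    rcases hΔ with h | h
    · exact h43 (Finset.mem_union_left _ ((mem_tuplesIn.1 h) i))
    · exact h43 ((mem_crossT.1 h).1 i)
  · rw [hT1, Finset.mem_union] at hΔ
    rcases hΔ with h | h
    · exact Finset.mem_union_left _ ((mem_tuplesIn.1 (Finset.mem_sdiff.1 h).1) i)
    · exact (mem_crossT.1 (Finset.mem_sdiff.1 h).1).1 i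

/-- **THE PER-BOX RELATION ON PRINT'S OBJECTS, SHIFTED KERNEL FIELD, WITH THE APPENDIX-D INPUTS SUPPLIED** — row 8's `perBox_shift` with
`δ₂₉(k) = 2^{kD}2^{2^{kD}}K₀^{kD}·e^{−(δ/2)(v+1)}·M̃^k` ((5.29)₂: row 3's `abs_ursellOf_tupleSums_shift_le_exp_of_separated` with `R_A = □′∖Γ₄(□)` —
every `Ψ″₁`-tuple meets it, `…Eq524.exists_mem_core_sdiff_frame4` — and `R_B = Γ₁(□)∪Γ₂(□)` — every `Ψ₂`-tuple lies there —, `ℓ¹ ≥ v + 1` across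
`Γ₄(□)` by `…LegGeometry.le_l1_core_sdiff_frame4_of_not_mem_core`; decay row (b) at any rate `0 ≤ δ ≤ δ₀`) and
`δ₃₁(k) = M^k·2^{kD}2^{2^{kD}}·kD·K₀^{kD}·ε₃₁` ((5.31): row 3's `abs_ursellOf_tupleSums_shift_sub_kernel_le` against the CENTRED reference field
`𝒩(0,K_r)` — the `Ψ′₁`/`Ψ″₁` tesserae lie in `□′∪Γ₃(□) = shrink (w + (w−v))`, where rows (d)/(e) give `|u| ≤ ε₃₁`, `|K − K_r| ≤ ε₃₁`; a-priori row
(a) `|K|, |K_r| ≤ K₀`, row (c) `|u| ≤ Kᵤ ≤ K₀` on `I`).  Rows (f) `K(x,x) ≤ ½`, `|u(x)| ≤ ½b(1+d(Δ_x,I))` on `□′∪Γ₂(□)`, (g) `K(y,y) ≤ c₀`,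
`K_r(y,y) ≤ c_r`, (h) «`z = ξ` on `Γ`, a.s.» as in row 8; the masses `M`, `M̃` stay displayed.  Same five-fold conclusion as `perBox_shift`,
reference cumulants under `𝒩(0,K_r)`.  The concrete `…Sect5PerBoxAppD.perBox_condField_appD` is the instance `K := condCov (freeCov …) Γ`,
`u := condMean … ξ`, `K_r := freeCov d α β`. [cite: BenfattoEtAl1978, (5.29)–(5.33) pp.157–159, (5.36) p.159] -/
theorem perBox_shift_appD (hK : IsPosSemidefKernel K) (u : B1Eq324BenfattoLemma.Site d → ℝ) {c₀ : ℝ≥0} (hdiag : ∀ y, K y y ≤ c₀)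
    (hKr : IsPosSemidefKernel Kr) {cr : ℝ≥0} (hdiagr : ∀ y, Kr y y ≤ cr)
    (hκ : 0 < κ) (hJ : CoefSupportedIn a J) (hJI : J ⊆ I) (hA0 : 0 ≤ A)
    (hA : ∀ (p : ℕ) (Δ : Fin p → B1Eq324BenfattoLemma.Site d) (n : Fin p → ℕ), |a p Δ n| ≤ A)
    (hv : v ≤ w) (hb : 1 ≤ b) (hγ1 : γ ≤ 1)
    {Ku K₀ δ₀ ε₃₁ : ℝ} (hKu : 0 ≤ Ku) (hKuK : Ku ≤ K₀) (hK₀1 : 1 ≤ K₀) (hε₃₁ : 0 ≤ ε₃₁)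
    (hu : ∀ y ∈ I, |u y| ≤ Ku)
    (hKR : ∀ x y, |K x y| ≤ K₀) (hKrR : ∀ x y, |Kr x y| ≤ K₀)
    (hdec : ∀ x y : B1Eq324BenfattoLemma.Site d, |K x y| ≤ K₀ * Real.exp (-(δ₀ * ∑ jj, |((x jj : ℝ) - (y jj : ℝ))|)))
    (huε : ∀ x ∈ shrink L m (w + (w - v)), |u x| ≤ ε₃₁)
    (hKε : ∀ x ∈ shrink L m (w + (w - v)), ∀ y, |K x y - Kr x y| ≤ ε₃₁)
    (hvar : ∀ x ∈ shrink L m w, K x x ≤ 1 / 2) (hm : ∀ x ∈ shrink L m w, |u x| ≤ 1 / 2 * b * (1 + distToRegion I x))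
    (hΓ : frame1 L w m ⊆ Γ) (hξ : ∀ c ∈ Γ, |ξ c| ≤ γ * b * (1 + distToRegion I c))
    (hae : ∀ᵐ z ∂((gaussianFieldOfKernel K).map
        fun (ζ : B1Eq324BenfattoLemma.Site d → ℝ) (y : B1Eq324BenfattoLemma.Site d) => u y + ζ y), ∀ c ∈ Γ, z c = ξ c)
    (hsmall : ((shrink L m w).card : ℝ) * Real.exp (-(b ^ 2 / 4)) ≤ 1 / 6)
    (T : Fin 3 → (p : ℕ) → Finset (Fin p → J))
    (hT0 : ∀ p, T 0 p = tuplesIn J p (frame4 L w v m) ∪ crossT J p (frame4 L w v m) (frame3 L w v m))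
    (hT1 : ∀ p, T 1 p = (tuplesIn J p (core L w m) \ tuplesIn J p (frame4 L w v m)) ∪
      (crossT J p (core L w m) (frame3 L w v m) \ crossT J p (frame4 L w v m) (frame3 L w v m)))
    (hT2 : ∀ p, T 2 p = crossT J p (frame1 L w m) (frame2 L w m) ∪ tuplesIn J p (frame2 L w m))
    (hM : ∀ c, ∑ p ∈ Finset.Icc 1 s, ∑ Δ ∈ T c p, ∑ n ∈ admissible p D,
      |a p (fun i => (Δ i : B1Eq324BenfattoLemma.Site d)) n| *
        Real.exp (-(κ / 2) * connLength fun i => (Δ i : B1Eq324BenfattoLemma.Site d)) ≤ M)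
    {δ : ℝ} (hδ0 : 0 ≤ δ) (hδle : δ ≤ δ₀) {Mt : ℝ}
    (hMt : ∀ c, ∑ p ∈ Finset.Icc 1 s, ∑ Δ ∈ T c p, ∑ n ∈ admissible p D,
      |a p (fun i => (Δ i : B1Eq324BenfattoLemma.Site d)) n| *
        Real.exp (-(κ / 2) * connLength fun i => (Δ i : B1Eq324BenfattoLemma.Site d)) *
        Real.exp (δ / 2 * ((D : ℝ) ^ 2 * (Real.sqrt d * connLength (fun i => (Δ i : B1Eq324BenfattoLemma.Site d)) + d))) ≤ Mt)
    (t : ℕ) :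
    let Kc : ℝ := 4 * (s1Const s D d κ * A * b ^ D * (L : ℝ) ^ d)
    let ε : ℝ := s1Const s D d κ * A * b ^ D * Real.exp (-(κ / 4 * v)) * (L : ℝ) ^ d
    let W : ℝ := 3 * (((shrink L m w).card : ℝ) * Real.exp (-(b ^ 2 / 4)))
    let cχ : ℕ → ℝ := fun k => 2 ^ k * ((∑ π ∈ setPartitions (univ : Finset (Fin k)), ((π.card - 1)! : ℝ)) *
        ((min 1 (2 * ((shrink L m w).card : ℝ) * Real.exp (-(b ^ 2 / 4)))) ^ ((2 * k : ℕ) : ℝ)⁻¹ *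
          ((1 + Ku) ^ D * M * momentConst D (2 * k) c₀) ^ k))
    let δ₂₉ : ℕ → ℝ := fun k => 2 ^ (k * D) * 2 ^ 2 ^ (k * D) * K₀ ^ (k * D) * Real.exp (-(δ / 2 * ((v : ℝ) + 1))) * Mt ^ k
    let δ₃₁ : ℕ → ℝ := fun k => M ^ k * (2 ^ (k * D) * 2 ^ 2 ^ (k * D) * ((k * D : ℕ) * K₀ ^ (k * D) * ε₃₁))
    let lhs : ℝ := ∫ z in smallFieldOn (shrink L m w : Set (B1Eq324BenfattoLemma.Site d)) I b,
          Real.exp (psiBox s D κ a L w m z) ∂((gaussianFieldOfKernel K).map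
            fun (ζ : B1Eq324BenfattoLemma.Site d → ℝ) (y : B1Eq324BenfattoLemma.Site d) => u y + ζ y)
    let rhs : ℝ := ∫ z in smallFieldOn (shrink L m w : Set (B1Eq324BenfattoLemma.Site d)) I b,
          Real.exp (psi1p s D κ a L w v m z + psi2 s D κ a L w m z) ∂((gaussianFieldOfKernel K).map
            fun (ζ : B1Eq324BenfattoLemma.Site d → ℝ) (y : B1Eq324BenfattoLemma.Site d) => u y + ζ y)
    let E : ℝ := ∑ k ∈ Finset.range t,
            (∑ f ∈ univ.filter (fun f : Fin (k + 1) → Fin 3 => (∃ j, f j = 1) ∧ ∀ j, f j ≠ 2),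
              ursellOf (fun P : Finset (Fin (k + 1)) => ∫ z, ∏ j ∈ P,
                (∑ p ∈ Finset.Icc 1 s, ∑ Δ ∈ T (f j) p, ∑ n ∈ admissible p D, term κ a z p Δ n)
                  ∂(gaussianFieldOfKernel Kr)) univ)
              / (k + 1)!
    let Err : ℝ := 2 * (2 ^ ((t + 1).choose 2) * Kc ^ (t + 1) / (t + 1)!) + Real.exp (2 * Kc) * W
        + ∑ k ∈ Finset.range t,
            (3 ^ (k + 1) * ((∑ π ∈ setPartitions (univ : Finset (Fin (k + 1))), ((π.card - 1)! : ℝ)) * (ε * Kc ^ k))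
              + 3 ^ (k + 1) * (cχ (k + 1) + δ₂₉ (k + 1)) + 3 ^ (k + 1) * (cχ (k + 1) + δ₃₁ (k + 1))) / (k + 1)!
    0 < lhs ∧ 0 < rhs ∧ |Real.log lhs - Real.log rhs - E| ≤ Err ∧
      Real.exp (E - Err) * rhs ≤ lhs ∧ lhs ≤ Real.exp (E + Err) * rhs := by
  intro Kc ε W cχ δ₂₉ δ₃₁
  -- constants
  have hK₀0 : 0 ≤ K₀ := zero_le_one.trans hK₀1
  have hM0 : 0 ≤ M := (Finset.sum_nonneg fun p _ => Finset.sum_nonneg fun Δ _ => Finset.sum_nonneg fun n _ =>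
    mul_nonneg (abs_nonneg _) (Real.exp_pos _).le).trans (hM 0)
  have hmass0 : ∀ c, 0 ≤ ∑ p ∈ Finset.Icc 1 s, ∑ Δ ∈ T c p, ∑ n ∈ admissible p D,
      |a p (fun i => (Δ i : B1Eq324BenfattoLemma.Site d)) n| *
        Real.exp (-(κ / 2) * connLength fun i => (Δ i : B1Eq324BenfattoLemma.Site d)) := fun c =>
    Finset.sum_nonneg fun p _ => Finset.sum_nonneg fun Δ _ => Finset.sum_nonneg fun n _ =>
      mul_nonneg (abs_nonneg _) (Real.exp_pos _).le
  have hmasst0 : ∀ c, 0 ≤ ∑ p ∈ Finset.Icc 1 s, ∑ Δ ∈ T c p, ∑ n ∈ admissible p D,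
      |a p (fun i => (Δ i : B1Eq324BenfattoLemma.Site d)) n| *
        Real.exp (-(κ / 2) * connLength fun i => (Δ i : B1Eq324BenfattoLemma.Site d)) *
        Real.exp (δ / 2 * ((D : ℝ) ^ 2 * (Real.sqrt d * connLength (fun i => (Δ i : B1Eq324BenfattoLemma.Site d)) + d))) :=
    fun c => Finset.sum_nonneg fun p _ => Finset.sum_nonneg fun Δ _ => Finset.sum_nonneg fun n _ =>
      mul_nonneg (mul_nonneg (abs_nonneg _) (Real.exp_pos _).le) (Real.exp_pos _).le
  have hMt0 : 0 ≤ Mt := (hmasst0 0).trans (hMt 0)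
  have happ : ∀ n : ℕ, (0 : ℝ) ≤ 2 ^ n * 2 ^ 2 ^ n * K₀ ^ n := fun n =>
    mul_nonneg (mul_nonneg (pow_nonneg (by norm_num) _) (pow_nonneg (by norm_num) _)) (pow_nonneg hK₀0 _)
  have hδ₂₉0 : ∀ k, 0 ≤ δ₂₉ k := fun k => by
    show (0 : ℝ) ≤ 2 ^ (k * D) * 2 ^ 2 ^ (k * D) * K₀ ^ (k * D) * Real.exp (-(δ / 2 * ((v : ℝ) + 1))) * Mt ^ k
    exact mul_nonneg (mul_nonneg (happ _) (Real.exp_pos _).le) (pow_nonneg hMt0 _)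
  have happ' : ∀ n : ℕ, (0 : ℝ) ≤ 2 ^ n * 2 ^ 2 ^ n * ((n : ℕ) * K₀ ^ n * ε₃₁) := fun n =>
    mul_nonneg (mul_nonneg (pow_nonneg (by norm_num) _) (pow_nonneg (by norm_num) _))
      (mul_nonneg (mul_nonneg (Nat.cast_nonneg _) (pow_nonneg hK₀0 _)) hε₃₁)
  have hδ₃₁0 : ∀ k, 0 ≤ δ₃₁ k := fun k => by
    show (0 : ℝ) ≤ M ^ k * (2 ^ (k * D) * 2 ^ 2 ^ (k * D) * ((k * D : ℕ) * K₀ ^ (k * D) * ε₃₁))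
    exact mul_nonneg (pow_nonneg hM0 _) (happ' _)
  -- row (c) on `I`: the centre is `≤ K₀` at every tessera of every class
  have huK : ∀ c, ∀ p ∈ Finset.Icc 1 s, ∀ Δ ∈ T c p, ∀ i,
      |u (Δ i : B1Eq324BenfattoLemma.Site d)| ≤ K₀ := fun c p _ Δ _ i =>
    (hu _ (hJI (Δ i).2)).trans hKuK
  -- the (5.29)₂ input, per colouring using `Ψ″₁` and `Ψ₂`
  have h29 : ∀ k < t, ∀ f : Fin (k + 1) → Fin 3, (∃ j, f j = 1) → (∃ j, f j = 2) →
      |ursellOf (fun P : Finset (Fin (k + 1)) => ∫ z, ∏ j ∈ P,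
          (∑ p ∈ Finset.Icc 1 s, ∑ Δ ∈ T (f j) p, ∑ n ∈ admissible p D, term κ a z p Δ n)
            ∂((gaussianFieldOfKernel K).map
              fun (ζ : B1Eq324BenfattoLemma.Site d → ℝ) (y : B1Eq324BenfattoLemma.Site d) => u y + ζ y)) univ|
        ≤ δ₂₉ (k + 1) := by
    intro k _ f h1 h2
    obtain ⟨j₁, hj₁⟩ := h1
    obtain ⟨j₂, hj₂⟩ := h2
    have h := abs_ursellOf_tupleSums_shift_le_exp_of_separated
      (σ := Fin (k + 1)) (s := s) (D := D) (ϰ := κ) (a := a) hK u hdiag (fun j => T (f j)) hK₀1 hdec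
      (fun j p hp Δ hΔ i => huK (f j) p hp Δ hΔ i) hδ0 hδle j₁ j₂
      (shrink L m (2 * w + v) : Set (B1Eq324BenfattoLemma.Site d))
      (↑(frame1 L w m ∪ frame2 L w m) : Set (B1Eq324BenfattoLemma.Site d)) (ρ₀ := (v : ℝ) + 1)
      (fun p hp Δ hΔ => by
        rw [hj₁, hT1] at hΔ
        obtain ⟨i, hi⟩ := exists_mem_core_sdiff_frame4 hΔ
        exact ⟨i, Finset.mem_coe.2 hi⟩)
      (fun p hp Δ hΔ => by
        rw [hj₂, hT2] at hΔ
        have hp1 : 1 ≤ p := (Finset.mem_Icc.1 hp).1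
        refine ⟨⟨0, hp1⟩, Finset.mem_coe.2 ?_⟩
        rcases Finset.mem_union.1 hΔ with h | h
        · exact (mem_crossT.1 h).1 _
        · exact Finset.mem_union_right _ ((mem_tuplesIn.1 h) _))
      (fun x hx y hy => by
        rw [Finset.mem_coe, ← core_sdiff_frame4] at hx
        exact le_l1_core_sdiff_frame4_of_not_mem_core hx (not_mem_core_of_mem_frame1_union_frame2 (Finset.mem_coe.1 hy)))
    rw [Fintype.card_fin] at h
    refine h.trans ?_
    show _ ≤ 2 ^ ((k + 1) * D) * 2 ^ 2 ^ ((k + 1) * D) * K₀ ^ ((k + 1) * D) * Real.exp (-(δ / 2 * ((v : ℝ) + 1))) *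
      Mt ^ (k + 1)
    refine mul_le_mul_of_nonneg_left ?_ (mul_nonneg (happ _) (Real.exp_pos _).le)
    calc _ ≤ ∏ _j : Fin (k + 1), Mt := Finset.prod_le_prod (fun j _ => hmasst0 (f j)) fun j _ => hMt (f j)
      _ = Mt ^ (k + 1) := by rw [Finset.prod_const, Finset.card_univ, Fintype.card_fin]
  -- the (5.31) input, per colouring using `Ψ″₁` and avoiding `Ψ₂`, against the centred reference field `𝒩(0,K_r)`
  have h31 : ∀ k < t, ∀ f : Fin (k + 1) → Fin 3, (∃ j, f j = 1) → (∀ j, f j ≠ 2) →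
      |ursellOf (fun P : Finset (Fin (k + 1)) => ∫ z, ∏ j ∈ P,
            (∑ p ∈ Finset.Icc 1 s, ∑ Δ ∈ T (f j) p, ∑ n ∈ admissible p D, term κ a z p Δ n)
              ∂((gaussianFieldOfKernel K).map
                fun (ζ : B1Eq324BenfattoLemma.Site d → ℝ) (y : B1Eq324BenfattoLemma.Site d) => u y + ζ y)) univ -
        ursellOf (fun P : Finset (Fin (k + 1)) => ∫ z, ∏ j ∈ P,
            (∑ p ∈ Finset.Icc 1 s, ∑ Δ ∈ T (f j) p, ∑ n ∈ admissible p D, term κ a z p Δ n)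
              ∂(gaussianFieldOfKernel Kr)) univ|
        ≤ δ₃₁ (k + 1) := by
    intro k _ f _ h2
    have hf01 : ∀ j, f j = 0 ∨ f j = 1 := fun j => by
      have h := h2 j
      generalize f j = c at h ⊢
      fin_cases c
      · exact Or.inl rfl
      · exact Or.inr rfl
      · exact absurd rfl h
    -- tesserae of the `Ψ′₁`/`Ψ″₁` classes are at depth `w − v`
    have hdeep : ∀ j, ∀ p ∈ Finset.Icc 1 s, ∀ Δ ∈ T (f j) p, ∀ i,
        (Δ i : B1Eq324BenfattoLemma.Site d) ∈ shrink L m (w + (w - v)) := fun j p _ Δ hΔ i =>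
      mem_shrink_of_mem_class01 hv T hT0 hT1 (hf01 j) hΔ i
    have h := abs_ursellOf_tupleSums_shift_sub_kernel_le
      (σ := Fin (k + 1)) (s := s) (D := D) (ϰ := κ) (a := a) hK hKr u hdiag hdiagr (fun j => T (f j)) hK₀1 hε₃₁
      (fun j p hp Δ hΔ i => huK (f j) p hp Δ hΔ i) (fun j j' p _ p' _ Δ _ Δ' _ i i' => hKR _ _)
      (fun j j' p _ p' _ Δ _ Δ' _ i i' => hKrR _ _)
      (fun j p hp Δ hΔ i => huε _ (hdeep j p hp Δ hΔ i))
      (fun j j' p hp p' _ Δ hΔ Δ' _ i i' => hKε _ (hdeep j p hp Δ hΔ i) _)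
    rw [Fintype.card_fin] at h
    refine h.trans ?_
    show _ ≤ M ^ (k + 1) * (2 ^ ((k + 1) * D) * 2 ^ 2 ^ ((k + 1) * D) * (((k + 1) * D : ℕ) * K₀ ^ ((k + 1) * D) * ε₃₁))
    refine mul_le_mul_of_nonneg_right ?_ (happ' _)
    calc _ ≤ ∏ _j : Fin (k + 1), M := Finset.prod_le_prod (fun j _ => hmass0 (f j)) fun j _ => hM (f j)
      _ = M ^ (k + 1) := by rw [Finset.prod_const, Finset.card_univ, Fintype.card_fin]
  exact perBox_shift hK u hdiag (gaussianFieldOfKernel Kr) hκ hJ hJI hA0 hA hv hb hγ1 hKu hu hvar hm hΓ hξ hae hsmall T hT0 hT1 hT2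
    hM hδ₂₉0 hδ₃₁0 h29 h31

end Plug

end Literature.MathematicalPhysics.QuantumFieldTheory.Balaban1983to89.B1Eq324BenfattoKernelSect5PerBoxAppD
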